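import Summits.QuantumFields.YangMills.Theorems.AlphaInputsT3ACv3StartCert
import HarnessLib

/-!
# `AlphaInputsT3ACv3StartS6Numerals` — START v3.1 for the (FL) `hLift` binder: **THE THREE (S6) SMALLNESS ROWS OF THE START CERTIFICATE ARE ONE CLOSED ROW, LINEAR IN `ε′`** —
# the displayed hypotheses `hmS6`, `h32`, `hNδ` of ★★★ `TubeStart.startT3_cert` (✓ p603720) at `b′ := startBd F K k ε′` follow from `16 ≤ Lᵏ`, `0 ≤ ε′` and the single absolute
# row `10²²·L·ε′ ≤ 1` (`|n| = 2` for `hNδ`) — lane `pub-balaban3d` ∕ cell `ym3-torus`, width seat `ym-ust-19936-w2` (g3)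

WHY (LEAD ★w1-19936 g2 PROGRESS 7∕9, 2026-08-28: «the (S6) rows `hmS6`∕`h32`∕`hNδ` join (K1)–(K7) as linear-in-ε′ rows with L-dependent numerals, absorbed by `B₀(L)` per
FL-SMALL (c′)»; the M22 knit `hLift_clause_of_start` ∕ `startT3_cert_omega` consumes `startT3_cert` and wants its START-side residue reduced to `hsep` + numerals).  The common
factor of the three rows is the two-cell defect budget `X := (d+1)·Lᵏ·((d⌊Lᵏ∕2⌋ + Lᵏ)·δ₀)`, `δ₀ = startBd F K k ε′ ≤ 83559424·ε′∕(Lᵏ)²` (`startBd_le`); ★w5's k-free numeral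
`eta0_le_of_boxBound` gives `2X ≤ (d+1)(d+2)·83559424·ε′`, i.e. `X ≤ 835594240·ε′` at `d = 3`.  Then `h32` reads `32·(5L)·X ≤ 1`, `hNδ` reads `4·(5L)·X < δ_SU = 1∕3`
(`|n| = 2`), and `hmS6` reads `(4·18³·(2 + 4·18³))·(324·(5L)²∕(L(L−1)))·X ≤ 1` with `L∕(L−1) ≤ 2` (`L ≥ 2`): all three are `c·L·ε′ ≤ 1` rows with closed `c ≤ 10²²`.
WHAT (def-free; namespace `TubeStart`, the letters of `startT3_cert` VERBATIM at `P := F.P K`).  §0 casts (`3 ≤ F.L`, `((d+2)·L : ℕ) = 5·L`); §1 ★ `S6core_le`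
(`X ≤ 835594240·ε′`), `S6core_nonneg`; §2 ★ `h32_of_le` (`133695078400·L·ε′ ≤ 1 ⇒ h32`); §3 `deltaSU_eq_third_of_card_two`, ★ `hNδ_of_lt` (`50135654400·L·ε′ < 1 ⇒ hNδ`);
§4 `hmS6_coeff_le` (the `L∕(L−1)` coefficient `≤ 8816724288000`), ★ `hmS6_of_le` (`7367204030720901120000·ε′ ≤ 1 ⇒ hmS6`); §5 ★★ `S6rows_of_le`: the three rows together from
`16 ≤ Lᵏ`, `0 ≤ ε′`, `10²²·L·ε′ ≤ 1`, `|n| = 2` — so a consumer discharges them with `ε_FL ≤ 10⁻²²∕L`.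
HONEST FRAMING.  Arithmetic only; (FL)∕`hLift`, the stub `stub_laneRecordsV3Chi`, the crux `HistoryTailL` and any gap are NOT claimed; count-neutral helper toward R3 2′∕2′χ
(items 19936∕19935, `--supports stmt-QuantumFields-19936`); registry untouched.  YM₃ on the three-torus is rung R3 of the programme, not the Clay problem: nothing here is about
d = 4, infinite volume, or a mass gap.

References: T. Bałaban, Commun. Math. Phys. 102 (1985) 277–309 [Balaban1985Variational] (Thm 1 (8) p.279, (11)–(15) pp.279–280); Commun. Math. Phys. 98 (1985) 17–51
[Balaban1985Averaging] ((8)–(9), (12) p.19).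
-/

set_option autoImplicit false

namespace Summit.QuantumFields.YangMills.Theorems.TubeStart

open Literature.MathematicalPhysics.QuantumFieldTheory.Balaban1983to89
open ExpMeanLog (deltaSU)
open Literature.MathematicalPhysics.QuantumFieldTheory.Balaban1983to89.T3ContinuumYM3Torus (T3Family)

variable (F : T3Family) (K : ℕ) (k : ℕ)

/-! ## §0 The family's casts -/

/-- `3 ≤ L` as reals for a `T3Family` (`L` odd and `> 1`; stated for `F.L`, the family's own letter). [folklore] -/
theorem three_le_T3Family_L : (3 : ℝ) ≤ (F.L : ℝ) := by
  have h : 3 ≤ F.L := by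
    obtain ⟨⟨j, hj⟩, h1⟩ := F.hL
    omega
  exact_mod_cast h

/-- The cast `((d+2)·L : ℕ) = 5·L` at `d = 3` (`(F.P K).d = 3`, `(F.P K).L = F.L`, both definitional). [folklore] -/
theorem cast_d_add_two_mul_L : ((((F.P K).d + 2) * (F.P K).L : ℕ) : ℝ) = 5 * (F.L : ℝ) := by
  rw [T3Family.P_d, show (F.P K).L = F.L from rfl]; push_cast; ring

/-! ## §1 The common factor `X := (d+1)·Lᵏ·((d⌊Lᵏ∕2⌋ + Lᵏ)·δ₀) ≤ 835594240·ε′` -/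

/-- **★ THE TWO-CELL DEFECT BUDGET IS LINEAR IN `ε′`, k-FREE**: with `δ₀ := startBd F K k ε′`, `16 ≤ Lᵏ`, `0 ≤ ε′ ≤ 1∕4`:
`(d+1)·Lᵏ·((d⌊Lᵏ∕2⌋ + Lᵏ)·δ₀) ≤ 835594240·ε′` (`= 10·83559424·ε′`; ★w5 `eta0_le_of_boxBound` at `C := 83559424` ∘ `startBd_le`, `d = 3`).
[cite: Balaban1985Variational, Thm 1 (8) p.279, (11)–(13) pp.279–280] -/
theorem S6core_le (hm : 16 ≤ (F.P K).L ^ k) {ε' : ℝ} (hε0 : 0 ≤ ε') (hε4 : ε' ≤ 1 / 4) :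
    (((F.P K).d : ℝ) + 1) * ((F.P K).L : ℝ) ^ k * (((((F.P K).d * ((F.P K).L ^ k / 2) + (F.P K).L ^ k : ℕ)) : ℝ) * startBd F K k ε') ≤
      835594240 * ε' := by
  have h := eta0_le_of_boxBound (P := F.P K) (k := k) (startBd_nonneg F K k hε0) (startBd_le F K k hm hε0 hε4)
  have hd : ((F.P K).d : ℝ) = 3 := by rw [T3Family.P_d]; norm_num
  rw [hd] at h ⊢
  linarith

/-- `0 ≤ X` (`0 ≤ ε′`). [folklore] -/
theorem S6core_nonneg {ε' : ℝ} (hε0 : 0 ≤ ε') :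
    0 ≤ (((F.P K).d : ℝ) + 1) * ((F.P K).L : ℝ) ^ k * (((((F.P K).d * ((F.P K).L ^ k / 2) + (F.P K).L ^ k : ℕ)) : ℝ) * startBd F K k ε') := by
  have h1 : (0 : ℝ) ≤ ((F.P K).d : ℝ) + 1 := by positivity
  have h2 : (0 : ℝ) ≤ ((F.P K).L : ℝ) ^ k := by positivity
  have h3 : (0 : ℝ) ≤ ((((F.P K).d * ((F.P K).L ^ k / 2) + (F.P K).L ^ k : ℕ)) : ℝ) := by positivity
  exact mul_nonneg (mul_nonneg h1 h2) (mul_nonneg h3 (startBd_nonneg F K k hε0))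

/-! ## §2 Row `h32` -/

/-- **★ ROW `h32` FROM ONE CLOSED ROW**: `16 ≤ Lᵏ`, `0 ≤ ε′`, `133695078400·L·ε′ ≤ 1` (`= 32·5·835594240`) give
`32·((d+2)L)·X ≤ 1`, the displayed hypothesis `h32` of `startT3_cert` verbatim. [cite: Balaban1985Variational, Thm 1 (8) p.279, (14)–(15) p.280] -/
theorem h32_of_le (hm : 16 ≤ (F.P K).L ^ k) {ε' : ℝ} (hε0 : 0 ≤ ε') (hε : 133695078400 * (F.L : ℝ) * ε' ≤ 1) :
    32 * ((((F.P K).d + 2) * (F.P K).L : ℕ) : ℝ) *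
        ((((F.P K).d : ℝ) + 1) * ((F.P K).L : ℝ) ^ k * (((((F.P K).d * ((F.P K).L ^ k / 2) + (F.P K).L ^ k : ℕ)) : ℝ) * startBd F K k ε')) ≤ 1 := by
  have hL3 := three_le_T3Family_L F
  have hε4 : ε' ≤ 1 / 4 := by nlinarith
  have hX := S6core_le F K k hm hε0 hε4
  have hX0 := S6core_nonneg F K k (ε' := ε') hε0
  rw [cast_d_add_two_mul_L]
  calc 32 * (5 * (F.L : ℝ)) *
        ((((F.P K).d : ℝ) + 1) * ((F.P K).L : ℝ) ^ k * (((((F.P K).d * ((F.P K).L ^ k / 2) + (F.P K).L ^ k : ℕ)) : ℝ) * startBd F K k ε'))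
      ≤ 32 * (5 * (F.L : ℝ)) * (835594240 * ε') := mul_le_mul_of_nonneg_left hX (by positivity)
    _ = 133695078400 * (F.L : ℝ) * ε' := by ring
    _ ≤ 1 := hε

/-! ## §3 Row `hNδ` -/

/-- `δ_SU = 1∕3` for `|n| = 2` (`δ_SU n = min (1∕3) (π∕|n|)`, `π∕2 > 1∕3`). [folklore] -/
theorem deltaSU_eq_third_of_card_two {n : Type*} [Fintype n] (hn2 : Fintype.card n = 2) : deltaSU n = 1 / 3 := by
  unfold deltaSU
  rw [hn2]
  apply min_eq_left
  have := Real.pi_gt_three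
  push_cast
  linarith

/-- **★ ROW `hNδ` FROM ONE CLOSED ROW**: `16 ≤ Lᵏ`, `0 ≤ ε′`, `50135654400·L·ε′ < 1` (`= 3·4·5·835594240`) and `|n| = 2` give
`4·((d+2)L)·X < δ_SU n`, the displayed hypothesis `hNδ` of `startT3_cert` verbatim. [cite: Balaban1985Variational, Thm 1 (8) p.279, (14)–(15) p.280] -/
theorem hNδ_of_lt {n : Type*} [Fintype n] (hn2 : Fintype.card n = 2) (hm : 16 ≤ (F.P K).L ^ k) {ε' : ℝ} (hε0 : 0 ≤ ε')
    (hε : 50135654400 * (F.L : ℝ) * ε' < 1) :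
    4 * ((((F.P K).d + 2) * (F.P K).L : ℕ) : ℝ) *
        ((((F.P K).d : ℝ) + 1) * ((F.P K).L : ℝ) ^ k * (((((F.P K).d * ((F.P K).L ^ k / 2) + (F.P K).L ^ k : ℕ)) : ℝ) * startBd F K k ε')) < deltaSU n := by
  have hL3 := three_le_T3Family_L F
  have hε4 : ε' ≤ 1 / 4 := by nlinarith
  have hX := S6core_le F K k hm hε0 hε4
  rw [cast_d_add_two_mul_L, deltaSU_eq_third_of_card_two hn2]
  calc 4 * (5 * (F.L : ℝ)) *
        ((((F.P K).d : ℝ) + 1) * ((F.P K).L : ℝ) ^ k * (((((F.P K).d * ((F.P K).L ^ k / 2) + (F.P K).L ^ k : ℕ)) : ℝ) * startBd F K k ε'))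
      ≤ 4 * (5 * (F.L : ℝ)) * (835594240 * ε') := mul_le_mul_of_nonneg_left hX (by positivity)
    _ = (50135654400 * (F.L : ℝ) * ε') / 3 := by ring
    _ < 1 / 3 := by linarith

/-! ## §4 Row `hmS6` -/

/-- **THE `hmS6` COEFFICIENT IS A CLOSED NUMERAL**: at `d = 3`, `L ≥ 2`,
`(d+1)·(18^d·(2 + (d+1)·18^d))·(324·((d+2)L)²)∕(L(L−1)) = 544242240·8100·L∕(L−1) ≤ 8816724288000`. [folklore] -/
theorem hmS6_coeff_le :
    (((F.P K).d : ℝ) + 1) * ((18 : ℝ) ^ (F.P K).d * (2 + (((F.P K).d : ℝ) + 1) * (18 : ℝ) ^ (F.P K).d)) *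
        (324 * ((((F.P K).d + 2) * (F.P K).L : ℕ) : ℝ) ^ 2) / (((F.P K).L : ℝ) * (((F.P K).L : ℝ) - 1)) ≤ 8816724288000 := by
  have hL3 := three_le_T3Family_L F
  rw [cast_d_add_two_mul_L, show (F.P K).L = F.L from rfl]
  have hd : ((F.P K).d : ℝ) = 3 := by rw [T3Family.P_d]; norm_num
  have hd' : (F.P K).d = 3 := T3Family.P_d F K
  rw [hd, hd']
  have hden : (0 : ℝ) < (F.L : ℝ) * ((F.L : ℝ) - 1) := by nlinarith
  rw [div_le_iff₀ hden]
  -- `544242240·8100·L² ≤ 8816724288000·L·(L−1)` ⟸ `L ≤ 2(L−1)` ⟸ `2 ≤ L`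
  nlinarith

/-- `0 ≤` the `hmS6` coefficient. [folklore] -/
theorem hmS6_coeff_nonneg :
    0 ≤ (((F.P K).d : ℝ) + 1) * ((18 : ℝ) ^ (F.P K).d * (2 + (((F.P K).d : ℝ) + 1) * (18 : ℝ) ^ (F.P K).d)) *
        (324 * ((((F.P K).d + 2) * (F.P K).L : ℕ) : ℝ) ^ 2) / (((F.P K).L : ℝ) * (((F.P K).L : ℝ) - 1)) := by
  have hL3 := three_le_T3Family_L F
  rw [show (F.P K).L = F.L from rfl]
  have hden : (0 : ℝ) ≤ (F.L : ℝ) * ((F.L : ℝ) - 1) := by nlinarith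
  positivity

/-- **★ ROW `hmS6` FROM ONE CLOSED ROW**: `16 ≤ Lᵏ`, `0 ≤ ε′`, `7367204030720901120000·ε′ ≤ 1` (`= 8816724288000·835594240`) give the displayed hypothesis `hmS6` of
`startT3_cert` verbatim (the (S6) contraction-margin row of ★w5's `norm_startDefect_sub_one_le_twoCell`). [cite: Balaban1985Variational, Thm 1 (8) p.279, (14)–(15) p.280] -/
theorem hmS6_of_le (hm : 16 ≤ (F.P K).L ^ k) {ε' : ℝ} (hε0 : 0 ≤ ε') (hε : 7367204030720901120000 * ε' ≤ 1) :
    (((F.P K).d : ℝ) + 1) * ((18 : ℝ) ^ (F.P K).d * (2 + (((F.P K).d : ℝ) + 1) * (18 : ℝ) ^ (F.P K).d)) *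
          (324 * ((((F.P K).d + 2) * (F.P K).L : ℕ) : ℝ) ^ 2) / (((F.P K).L : ℝ) * (((F.P K).L : ℝ) - 1)) *
        ((((F.P K).d : ℝ) + 1) * ((F.P K).L : ℝ) ^ k * (((((F.P K).d * ((F.P K).L ^ k / 2) + (F.P K).L ^ k : ℕ)) : ℝ) * startBd F K k ε')) ≤ 1 := by
  have hε4 : ε' ≤ 1 / 4 := by linarith
  have hX := S6core_le F K k hm hε0 hε4
  have hX0 := S6core_nonneg F K k (ε' := ε') hε0
  have hC := hmS6_coeff_le F K
  have hC0 := hmS6_coeff_nonneg F K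
  calc (((F.P K).d : ℝ) + 1) * ((18 : ℝ) ^ (F.P K).d * (2 + (((F.P K).d : ℝ) + 1) * (18 : ℝ) ^ (F.P K).d)) *
          (324 * ((((F.P K).d + 2) * (F.P K).L : ℕ) : ℝ) ^ 2) / (((F.P K).L : ℝ) * (((F.P K).L : ℝ) - 1)) *
        ((((F.P K).d : ℝ) + 1) * ((F.P K).L : ℝ) ^ k * (((((F.P K).d * ((F.P K).L ^ k / 2) + (F.P K).L ^ k : ℕ)) : ℝ) * startBd F K k ε'))
      ≤ 8816724288000 * (835594240 * ε') := mul_le_mul hC hX hX0 (by norm_num)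
    _ = 7367204030720901120000 * ε' := by ring
    _ ≤ 1 := hε

/-! ## §5 The three rows together -/

/-- **★★ THE THREE (S6) ROWS OF `startT3_cert` FROM ONE ABSOLUTE ROW**: for `16 ≤ Lᵏ`, `0 ≤ ε′`, `10²²·L·ε′ ≤ 1` and `|n| = 2`, the displayed hypotheses `hmS6`, `h32`, `hNδ` of
★★★ `startT3_cert` at `b′ := startBd F K k ε′` all hold — so the M22 knit discharges them with any `ε_FL ≤ 10⁻²²∕L` (an L-dependent numeral absorbed by `B₀(L)`, FL-SMALL (c′)).
[cite: Balaban1985Variational, Thm 1 (8) p.279, (11)–(15) pp.279–280] -/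
theorem S6rows_of_le {n : Type*} [Fintype n] (hn2 : Fintype.card n = 2) (hm : 16 ≤ (F.P K).L ^ k) {ε' : ℝ} (hε0 : 0 ≤ ε')
    (hε : (10 : ℝ) ^ 22 * (F.L : ℝ) * ε' ≤ 1) :
    ((((F.P K).d : ℝ) + 1) * ((18 : ℝ) ^ (F.P K).d * (2 + (((F.P K).d : ℝ) + 1) * (18 : ℝ) ^ (F.P K).d)) *
          (324 * ((((F.P K).d + 2) * (F.P K).L : ℕ) : ℝ) ^ 2) / (((F.P K).L : ℝ) * (((F.P K).L : ℝ) - 1)) *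
        ((((F.P K).d : ℝ) + 1) * ((F.P K).L : ℝ) ^ k * (((((F.P K).d * ((F.P K).L ^ k / 2) + (F.P K).L ^ k : ℕ)) : ℝ) * startBd F K k ε')) ≤ 1) ∧
    (32 * ((((F.P K).d + 2) * (F.P K).L : ℕ) : ℝ) *
        ((((F.P K).d : ℝ) + 1) * ((F.P K).L : ℝ) ^ k * (((((F.P K).d * ((F.P K).L ^ k / 2) + (F.P K).L ^ k : ℕ)) : ℝ) * startBd F K k ε')) ≤ 1) ∧
    (4 * ((((F.P K).d + 2) * (F.P K).L : ℕ) : ℝ) *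
        ((((F.P K).d : ℝ) + 1) * ((F.P K).L : ℝ) ^ k * (((((F.P K).d * ((F.P K).L ^ k / 2) + (F.P K).L ^ k : ℕ)) : ℝ) * startBd F K k ε')) < deltaSU n) := by
  have hL3 := three_le_T3Family_L F
  have hLε : 0 ≤ (F.L : ℝ) * ε' := by positivity
  refine ⟨hmS6_of_le F K k hm hε0 ?_, h32_of_le F K k hm hε0 ?_, hNδ_of_lt F K k hn2 hm hε0 ?_⟩
  · -- `7.37·10²¹·ε′ ≤ 10²²·ε′ ≤ 10²²·L·ε′ ≤ 1`
    nlinarith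
  · nlinarith
  · nlinarith

end Summit.QuantumFields.YangMills.Theorems.TubeStart
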